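import Summits.MatrixMultiplication.MatrixMultiplication.Theorems.SoloInformedCrossIntersecting

/-!
# Structure lemma for sign-twisted triangle equations (multiplier group `{±1}`)

This work, §8.4b. In a CU13 Def.-12 realization of `⟨n,n,n⟩` in a translation scheme `𝒮(S, {±1})`
the orbit representatives satisfy the twisted triangle equations
`a(i,j) + σ b(j,k) + ρ c(k,i) = 0` (`σ, ρ = ±1` depending on the cell triple). Comparing the equations
at `(i,j,k)` and `(i,j',k)` (same `c(k,i)`) for two columns `j ≠ j'` shows that for every `i, k` one of
`u' i - u i`, `u' i + u i` agrees up to sign with one of `v' k + v k`, `v' k - v k`, where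
`u = a(·,j)`, `u' = a(·,j')`, `v = b(j,·)`, `v' = b(j',·)` (`twisted_difference_relation`). The
cross-intersecting-pairs lemma (`cross_intersecting_pairs`) then yields the STRUCTURE LEMMA
(`structure_lemma_pm`): either the two rows `v, v'` of `b` are twisted translates of each other by a
single shift `δ` (`v' k = ±v k ± δ` for every `k`), or the two columns `u, u'` of `a` are plain translates
up to at most twelve shifts (`u' i - u i ∈ H`, `|H| ≤ 12`, for every `i`). No fixed-point-freeness and no
separation condition is used: this is pure triangle-equation structure, the first step of the proof
strategy for Conjecture C3 (Theorem C2 without fixed-point-freeness) at `m = 2`.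
References: this work §8; CohnUmans2013 (arXiv:1207.6528) Def. 12.
-/

namespace Summit.MatrixMultiplication.MatrixMultiplication.Theorems.TwistedTPP

open Finset

variable {S : Type*} [AddCommGroup S] [DecidableEq S]

/-- `pm x y`: `x` agrees with `y` up to sign. -/
def pm (x y : S) : Prop := x = y ∨ x = -y

/-- The sign class `{x, -x}` of `x`. -/
def cls (x : S) : Finset S := {x, -x}

/-- `x` lies in its own sign class. -/
theorem mem_cls_self (x : S) : x ∈ cls x := by simp [cls]

/-- A sign class has at most two elements. -/
theorem card_cls_le (x : S) : (cls x).card ≤ 2 := by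
  unfold cls; exact card_insert_le _ _

/-- Elements agreeing up to sign have the same sign class. -/
theorem cls_eq_of_pm {x y : S} (h : pm x y) : cls x = cls y := by
  rcases h with rfl | rfl
  · rfl
  · ext w; simp [cls, or_comm]

/-- Elements with the same sign class agree up to sign. -/
theorem pm_of_cls_eq {x y : S} (h : cls x = cls y) : pm x y := by
  have hx : x ∈ cls y := h ▸ mem_cls_self x
  simpa [cls, pm] using hx

omit [DecidableEq S] in
/-- **From the triangle equations to the difference relation.** If `x + σ y + ρ w = 0` and
`x' + σ' y' + ρ' w = 0` with signs `σ, σ', ρ, ρ' = ±1` (written out as the four sign cases) and the same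
third term `w` (`= c(k,i)`), then one of `x' - x`, `x' + x` agrees up to sign with one of `y' + y`,
`y' - y`. [this work, §8.4b] -/
theorem twisted_difference_relation {x x' y y' w : S}
    (h : x + y + w = 0 ∨ x + y - w = 0 ∨ x - y + w = 0 ∨ x - y - w = 0)
    (h' : x' + y' + w = 0 ∨ x' + y' - w = 0 ∨ x' - y' + w = 0 ∨ x' - y' - w = 0) :
    pm (x' - x) (y' + y) ∨ pm (x' - x) (y' - y) ∨ pm (x' + x) (y' + y) ∨ pm (x' + x) (y' - y) := by
  unfold pm
  rcases h with h | h | h | h <;> rcases h' with h' | h' | h' | h' <;>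
    first
    | (left; left; linear_combination (norm := abel1) h' - h)
    | (left; right; linear_combination (norm := abel1) h' - h)
    | (right; left; left; linear_combination (norm := abel1) h' - h)
    | (right; left; right; linear_combination (norm := abel1) h' - h)
    | (right; right; left; left; linear_combination (norm := abel1) h' + h)
    | (right; right; left; right; linear_combination (norm := abel1) h' + h)
    | (right; right; right; left; linear_combination (norm := abel1) h' + h)
    | (right; right; right; right; linear_combination (norm := abel1) h' + h)

/-- **Structure lemma (pure triangle-equation structure, multiplier group `{±1}`).** Let `u, u'` be two
columns of `a` and `v, v'` the corresponding two rows of `b`, and suppose that for every `i, k` one of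
`u' i - u i`, `u' i + u i` agrees up to sign with one of `v' k + v k`, `v' k - v k` (as produced by
`twisted_difference_relation`). Then EITHER the rows are twisted translates by one shift — some `δ` with
`v' k + v k = ±δ` or `v' k - v k = ±δ` for every `k` — OR the columns are plain translates up to twelve
shifts — some `H` with `|H| ≤ 12` and `u' i - u i ∈ H` for every `i`. [this work, §8.4b] -/
theorem structure_lemma_pm {I K : Type*} [Nonempty K] (u u' : I → S) (v v' : K → S)
    (H : ∀ i k, pm (u' i - u i) (v' k + v k) ∨ pm (u' i - u i) (v' k - v k) ∨
      pm (u' i + u i) (v' k + v k) ∨ pm (u' i + u i) (v' k - v k)) :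
    (∃ δ : S, ∀ k, pm (v' k + v k) δ ∨ pm (v' k - v k) δ) ∨
      ∃ H : Finset S, H.card ≤ 12 ∧ ∀ i, u' i - u i ∈ H := by
  classical
  set F : I → Finset (Finset S) := fun i => {cls (u' i - u i), cls (u' i + u i)} with hFdef
  set G : K → Finset (Finset S) := fun k => {cls (v' k + v k), cls (v' k - v k)} with hGdef
  have hF : ∀ i, (F i).card ≤ 2 := fun i => (card_insert_le _ _).trans (by simp)
  have hG : ∀ k, (G k).card ≤ 2 := fun k => (card_insert_le _ _).trans (by simp)
  have hX : ∀ i k, (F i ∩ G k).Nonempty := by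
    intro i k
    rcases H i k with h | h | h | h
    · exact ⟨cls (u' i - u i), mem_inter.mpr ⟨by simp [F], by simp [G, cls_eq_of_pm h]⟩⟩
    · exact ⟨cls (u' i - u i), mem_inter.mpr ⟨by simp [F], by simp [G, cls_eq_of_pm h]⟩⟩
    · exact ⟨cls (u' i + u i), mem_inter.mpr ⟨by simp [F], by simp [G, cls_eq_of_pm h]⟩⟩
    · exact ⟨cls (u' i + u i), mem_inter.mpr ⟨by simp [F], by simp [G, cls_eq_of_pm h]⟩⟩
  rcases cross_intersecting_pairs F G hF hG hX with ⟨c, hc⟩ | ⟨U, hU, hFU⟩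
  · -- a class common to all `G k`: it is `cls δ` for `δ = v' k₁ ± v k₁`
    left
    obtain ⟨k₁⟩ := ‹Nonempty K›
    have hc1 : c = cls (v' k₁ + v k₁) ∨ c = cls (v' k₁ - v k₁) := by simpa [G] using hc k₁
    have key : ∀ δ, c = cls δ → ∀ k, pm (v' k + v k) δ ∨ pm (v' k - v k) δ := by
      rintro δ rfl k
      have hk : cls δ = cls (v' k + v k) ∨ cls δ = cls (v' k - v k) := by simpa [G] using hc k
      rcases hk with hk | hk
      · exact Or.inl (pm_of_cls_eq hk.symm)
      · exact Or.inr (pm_of_cls_eq hk.symm)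
    rcases hc1 with h1 | h1
    · exact ⟨_, key _ h1⟩
    · exact ⟨_, key _ h1⟩
  · -- all `F i` inside a set `U` of at most six classes: the differences lie in their union
    right
    refine ⟨(U.filter (fun c => c.card ≤ 2)).biUnion id, ?_, ?_⟩
    · calc ((U.filter (fun c => c.card ≤ 2)).biUnion id).card
            ≤ ∑ c ∈ U.filter (fun c => c.card ≤ 2), (id c).card := card_biUnion_le
        _ ≤ ∑ _c ∈ U.filter (fun c => c.card ≤ 2), 2 :=
            sum_le_sum fun c hc => by simpa using (mem_filter.mp hc).2
        _ = (U.filter (fun c => c.card ≤ 2)).card * 2 := by rw [sum_const, smul_eq_mul]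
        _ ≤ U.card * 2 := Nat.mul_le_mul_right 2 (card_filter_le _ _)
        _ ≤ 12 := by omega
    · intro i
      have hmem : cls (u' i - u i) ∈ U := hFU i (by simp [F])
      exact mem_biUnion.mpr ⟨cls (u' i - u i), mem_filter.mpr ⟨hmem, card_cls_le _⟩,
        mem_cls_self _⟩

end Summit.MatrixMultiplication.MatrixMultiplication.Theorems.TwistedTPP
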